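/-
Copyright (c) 2026 the pub-hodgecm-mathlib formalisation cell (harness21).  Prover seat hodgecm-mathlib-F0P3a-p04 (g18), 2026-09-01.  Road «S3-ram» seeding wave (LEAD T11-41;
owner F0P3a-p06 (g15)): row «(e3)-♯ χ♯ LEVI VALUE», place-level organ FILE A of 2 (split with F0P3a-p07 (g13), who files the HEAD `DepthZeroTransferHValuesLeviRamifiedModular`).
-/
import Literature.NumberTheory.Automorphic.UnitaryTwoRamifiedTreeStabilizers   -- ★ p843857 (this lineage, g14): `coe_mem_map_conj_glDiagonal_iff_forall_v_le_one`, `v_det_coe_eq_one_of_mem_placeForm`, `coe_mem_glInt_iff_forall_v_le_one`, `coe_glDiagonal_one_two{,_inv}`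
import Literature.NumberTheory.Automorphic.LineStrataMeasureRamified            -- ★ p846812 (p07 (g12)): the CM carriers of the Levi row + ★ `valued_galAdicCompletionMap_sub_lt_one_of_ramified` (Liu2021, `σ_w ≡ id mod 𝔪_w`)
import HarnessLib

/-!
# The edge stabiliser `K⁰ = U ∩ GL₂(𝒪_w)` of ramified `U(1,1)`: the RESIDUAL DICHOTOMY and the transports to the two vertex levels `K♯`, `K♭`
(Tits 1979 §2.7, §3.9; Serre, *Trees* II.1.3)

Topic `NumberTheory/Automorphic`; namespace `Literature.NumberTheory.Automorphic.UnitaryGroup`.  THEOREMS ONLY (no definition, no instance, no notation, no named fact,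
no `sorry`); kernel lane `--supports stmt-HodgeConjecture-24833`.  Cell `pub/hodgecm-mathlib`, crux H413; road «S3-ram» seeding wave (LEAD F0P3a-plan (g12) T11-41, owner∕table
F0P3a-p06 (g15) v1.6), row **«(e3)-♯ χ♯ LEVI VALUE»** (A-p16 (g31) χ♯ TEXT 21:55:49Z; ref5 (g4) R-226 (J)), split 22:11Z: FILE A (this file) + FILE B
`UnitaryTwoEdgeStabilizerVertexAverageRamified` (the `K⁰`-average, seat F0P3a-p04 (g18)); HEAD `Φ_H(⟦(t,u)⟧, χ♯) = ν_H(K_H)·((q+1)∕2)·J_H(t)` = F0P3a-p07 (g13).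
HONEST LABEL: HC_CM is proved only modulo the 2 remaining named inputs (hLiu418 24832, h413 24833) until rung 0 closes; «S3-ram» is Literature seeding, count-neutral;
this file asserts nothing printed and discharges nothing by itself.

THE MATHEMATICS.  `L` CM, `w ∣ v` a NON-SPLIT place (`c • w = w`), `U := U(σ_w, (Φ₂)_w)(L_w) ≤ GL₂(L_w)`, `(Φ₂)_w = antidiag(1,1)`, `K⁰ := U ∩ GL₂(𝒪_w)`.  At a TAME-RAMIFIED `w`
(`e(w|v) ≠ 1`, `|2|_w = 1`) `K⁰` is the stabiliser — WITH INVERSION — of an EDGE of the tree of `SL₂(L⁺_v)` [Tits1979, §3.9], whose endpoints have stabilisers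
`K♯ := U ∩ D GL₂(𝒪_w) D⁻¹` and `K♭ := U ∩ D′ GL₂(𝒪_w) D′⁻¹`, `D = diag(1, η)`, `D′ = diag(η, 1)`, `η` a uniformiser of `L_w` (★ `UnitaryTwoRamifiedTreeStabilizers`).
* §0 two-by-two bookkeeping (`diag·M·diag` entries, `antidiag(1,1)·M`, the `D`∕`D′` scalars, `glDiagonal ![η, 1]`).
* §1 THE RESIDUAL DICHOTOMY `valued_apply_dichotomy_of_mem_glInt_of_ramified` (`he`, `h2w` only): an integral unitary `κ ∈ K⁰` is residually DIAGONAL (`|κ₁₀|, |κ₀₁| < 1`)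
  or residually ANTIDIAGONAL (`|κ₀₀|, |κ₁₁| < 1`), never both (`not_diagType_and_antidiagType`): unitarity for `antidiag(1,1)` (★ `mem_unitaryGroupOfForm_antidiagonal_iff_sum'`)
  gives `σ(κ₀₀)κ₁₀ + σ(κ₁₀)κ₀₀ = 0 = σ(κ₀₁)κ₁₁ + σ(κ₁₁)κ₀₁`; `σ_w ≡ id (mod 𝔪_w)` at a ramified place (★ `valued_galAdicCompletionMap_sub_lt_one_of_ramified`) and `|2|_w = 1` turn
  these into `|κ₀₀κ₁₀| < 1`, `|κ₀₁κ₁₁| < 1`; `|det κ|_w = 1` sorts the cases (the residual group is `O(1,1)(𝔽_q) = {diag} ⊔ {antidiag}`).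
  THE ENTRY PREDICATES (A-p16 (g31)'s χ♯ text; ★ `coe_mem_map_conj_glDiagonal_iff_forall_v_le_one`): `P♯ M :⟺ ∀ a b, |η^b η^{−a} M_{ab}| ≤ 1 ⟺ M ∈ K♯`
  (`forall_v_sharp_iff_coe_mem_map_conj`) and `P♭ M :⟺ ∀ a b, |η^a η^{−b} M_{ab}| ≤ 1 ⟺ M ∈ K♭` (`forall_v_flat_iff_coe_mem_map_conj`), for unitary `M` (`|det M| = 1`).
  THE TRANSPORTS: diagonal-type `κ` ⇒ `D⁻¹κD ∈ GL₂(𝒪_w)` (`glDiagonal_inv_mul_mul_glDiagonal_mem_glInt_of_diagType`); antidiagonal-type `κ` ⇒ `D⁻¹κD′ ∈ GL₂(𝒪_w)`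
  (`glDiagonal_inv_mul_mul_glDiagonal'_mem_glInt_of_antidiagType`) — so diagonal-type elements NORMALISE both vertex levels and antidiagonal-type ones SWAP them (FILE B).

## References
* [Tits1979] J. Tits, *Reductive groups over local fields*, PSPM 33.1 (1979), §2.7, §3.9 (ramified quasi-split `U(2)`: the tree of `SL₂`, vertex vs edge stabilisers).
* [Serre1980Trees] J.-P. Serre, *Trees* (1980), Ch. II §1.3 (the two maximal compact subgroups; the edge stabiliser with inversion).
* [Serre1979] J.-P. Serre, *Local Fields*, GTM 67 (1979), Ch. I §7–§8 (tame inertia acts trivially on the residue field).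
* [Rogawski1990] J. D. Rogawski, *Automorphic Representations of Unitary Groups in Three Variables*, Ann. of Math. Stud. 123 (1990), §4.9 Lemma 4.9.3 p. 56.
-/

set_option autoImplicit false

noncomputable section

open MeasureTheory Measure Set Filter Topology NumberField IsDedekindDomain Matrix ValuativeRel
open scoped ENNReal NNReal ValuativeRel Matrix MatrixGroups

namespace Literature.NumberTheory.Automorphic.UnitaryGroup

open Literature.NumberTheory.Automorphic Literature.NumberTheory.Automorphic.HermitianLatticeTree
/-! ## §0 Two-by-two bookkeeping -/

section Algebra

/-- `(diag(d) · M · diag(e))_{ij} = d_i M_{ij} e_j`. [cite: Serre1980Trees, Ch. II §1.3] -/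
theorem diagonal_mul_mul_diagonal_apply_two {R : Type*} [CommRing R] (d e : Fin 2 → R) (M : Matrix (Fin 2) (Fin 2) R) (i j : Fin 2) :
    (diagonal d * M * diagonal e) i j = d i * M i j * e j := by
  rw [Matrix.mul_diagonal, Matrix.diagonal_mul]

/-- `antidiag(1,1) · M` exchanges the two ROWS of `M`. [cite: Serre1980Trees, Ch. II §1.3] -/
theorem antidiagOne_mul_eq_two {R : Type*} [CommRing R] (M : Matrix (Fin 2) (Fin 2) R) : !![(0 : R), 1; 1, 0] * M = !![M 1 0, M 1 1; M 0 0, M 0 1] := by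
  conv_lhs => rw [Matrix.eta_fin_two M]
  rw [Matrix.mul_fin_two]
  simp only [zero_mul, one_mul, zero_add, add_zero]

/-- `antidiag(1,1)² = 1`. [cite: Serre1980Trees, Ch. II §1.3] -/
theorem antidiagOne_mul_antidiagOne_two {R : Type*} [CommRing R] : !![(0 : R), 1; 1, 0] * !![(0 : R), 1; 1, 0] = 1 := by
  rw [Matrix.mul_fin_two, Matrix.one_fin_two]
  simp only [zero_add, add_zero, mul_one, mul_zero]

/-- The `D⁻¹ M D` scalars, `D = diag(1, η)`: `(1, η⁻¹)_a · x · (1, η)_b = η^b η^{−a} x`. [cite: Serre1980Trees, Ch. II §1.3] -/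
theorem vecTwo_sharp_scalar_eq {K : Type*} [Field K] (η : K) (hη : η ≠ 0) (x : K) (a b : Fin 2) :
    ![(1 : K), η⁻¹] a * x * ![(1 : K), η] b = η ^ (b : ℕ) * (η ^ (a : ℕ))⁻¹ * x := by
  fin_cases a <;> fin_cases b
  · simp
  · simp [mul_comm]
  · simp [mul_comm]
  · show η⁻¹ * x * η = η ^ (1 : ℕ) * (η ^ (1 : ℕ))⁻¹ * x
    rw [pow_one, mul_inv_cancel₀ hη, one_mul, mul_right_comm, inv_mul_cancel₀ hη, one_mul]

/-- The `D′⁻¹ M D′` scalars, `D′ = diag(η, 1)`: `(η⁻¹, 1)_a · x · (η, 1)_b = η^a η^{−b} x`. [cite: Serre1980Trees, Ch. II §1.3] -/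
theorem vecTwo_flat_scalar_eq {K : Type*} [Field K] (η : K) (hη : η ≠ 0) (x : K) (a b : Fin 2) :
    ![η⁻¹, (1 : K)] a * x * ![η, (1 : K)] b = η ^ (a : ℕ) * (η ^ (b : ℕ))⁻¹ * x := by
  fin_cases a <;> fin_cases b
  · show η⁻¹ * x * η = η ^ (0 : ℕ) * (η ^ (0 : ℕ))⁻¹ * x
    rw [pow_zero, inv_one, one_mul, one_mul, mul_right_comm, inv_mul_cancel₀ hη, one_mul]
  · simp [mul_comm]
  · simp [mul_comm]
  · show 1 * x * 1 = η ^ (1 : ℕ) * (η ^ (1 : ℕ))⁻¹ * x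
    rw [pow_one, mul_inv_cancel₀ hη, one_mul, mul_one]

/-- `glDiagonal ![η, 1]` is the matrix `diag(η, 1)`. [cite: Serre1980Trees, Ch. II §1.3] -/
theorem coe_glDiagonal_two_one {K : Type*} [Field K] (η : Kˣ) : ((glDiagonal 2 K ![η, 1] : GL (Fin 2) K) : Matrix (Fin 2) (Fin 2) K) = diagonal ![(η : K), 1] := by
  rw [coe_glDiagonal]
  congr 1
  funext k; fin_cases k <;> simp

/-- `(glDiagonal ![η, 1])⁻¹` is the matrix `diag(η⁻¹, 1)`. [cite: Serre1980Trees, Ch. II §1.3] -/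
theorem coe_glDiagonal_two_one_inv {K : Type*} [Field K] (η : Kˣ) : (((glDiagonal 2 K ![η, 1])⁻¹ : GL (Fin 2) K) : Matrix (Fin 2) (Fin 2) K) = diagonal ![(η : K)⁻¹, 1] := by
  rw [← map_inv, coe_glDiagonal]
  congr 1
  funext k; fin_cases k <;> simp [Units.val_inv_eq_inv_val]

end Algebra
/-! ## §1 At the place `w`: the residual dichotomy in `K⁰ = U ∩ GL₂(𝒪_w)`, the entry predicates `P♯`, `P♭`, and the transports `D⁻¹κD`, `D⁻¹κD′ ∈ GL₂(𝒪_w)` -/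

section Place

variable (L : Type) [Field L] [NumberField L] [IsCMField L] {v : HeightOneSpectrum (𝓞 ↥(maximalRealSubfield L))}
  (w : PlacesOver L v) (hw : IsCMField.complexConj L • w.1 = w.1)

include hw in
/-- **THE RESIDUAL DICHOTOMY IN `K⁰` AT A TAME-RAMIFIED PLACE.**  For `κ ∈ U(σ_w, (Φ₂)_w) ∩ GL₂(𝒪_w)`, `w` tame-ramified (`e(w|v) ≠ 1`, `|2|_w = 1`): either `|κ₁₀|_w < 1 ∧ |κ₀₁|_w < 1`
(residually diagonal) or `|κ₀₀|_w < 1 ∧ |κ₁₁|_w < 1` (residually antidiagonal) — unitarity for `antidiag(1,1)` (★ `mem_unitaryGroupOfForm_antidiagonal_iff_sum'`) reads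
`σ(κ₀₀)κ₁₀ + σ(κ₁₀)κ₀₀ = 0 = σ(κ₀₁)κ₁₁ + σ(κ₁₁)κ₀₁`, `σ_w ≡ id (mod 𝔪_w)` (★ `valued_galAdicCompletionMap_sub_lt_one_of_ramified`) and `|2|_w = 1` give `|κ₀₀κ₁₀| < 1`,
`|κ₀₁κ₁₁| < 1`, and `|det κ|_w = 1` excludes the mixed cases. [cite: Tits1979, §3.9] [cite: Serre1979, Ch. I §7–§8] -/
theorem valued_apply_dichotomy_of_mem_glInt_of_ramified (he : v.asIdeal.ramificationIdx' w.1.asIdeal ≠ 1) (h2w : Valued.v (2 : (w.1.adicCompletion L)) = 1)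
    (u : ↥(unitaryGroupOfForm (galAdicCompletionMap (L := L) (IsCMField.complexConj L) hw) (placeForm (Matrix.of fun i j : Fin 2 => if i.val + j.val + 1 = 2 then (1 : L) else 0) w.1))) (hu : (u : GL (Fin 2) (w.1.adicCompletion L)) ∈ glInt 2 (w.1.adicCompletion L)) :
    (Valued.v (((u : GL (Fin 2) (w.1.adicCompletion L)) : Matrix (Fin 2) (Fin 2) (w.1.adicCompletion L)) 1 0) < 1 ∧ Valued.v (((u : GL (Fin 2) (w.1.adicCompletion L)) : Matrix (Fin 2) (Fin 2) (w.1.adicCompletion L)) 0 1) < 1) ∨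
      (Valued.v (((u : GL (Fin 2) (w.1.adicCompletion L)) : Matrix (Fin 2) (Fin 2) (w.1.adicCompletion L)) 0 0) < 1 ∧ Valued.v (((u : GL (Fin 2) (w.1.adicCompletion L)) : Matrix (Fin 2) (Fin 2) (w.1.adicCompletion L)) 1 1) < 1) := by
  have hint : ∀ i j, Valued.v (((u : GL (Fin 2) (w.1.adicCompletion L)) : Matrix (Fin 2) (Fin 2) (w.1.adicCompletion L)) i j) ≤ 1 := (coe_mem_glInt_iff_forall_v_le_one L w hw u).1 hu
  have hdet : Valued.v (((u : GL (Fin 2) (w.1.adicCompletion L)) : Matrix (Fin 2) (Fin 2) (w.1.adicCompletion L))).det = 1 := v_det_coe_eq_one_of_mem_placeForm L w hw u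
  -- unitarity relations for the antidiagonal form
  have hU : (u : GL (Fin 2) (w.1.adicCompletion L)) ∈ unitaryGroupOfForm (galAdicCompletionMap (L := L) (IsCMField.complexConj L) hw) ((StdForm.antidiagonal 2).over (w.1.adicCompletion L)) := by
    rw [← placeForm_antidiagOne]; exact u.2
  have hrel := (mem_unitaryGroupOfForm_antidiagonal_iff_sum' (galAdicCompletionMap (L := L) (IsCMField.complexConj L) hw) 2 (u : GL (Fin 2) (w.1.adicCompletion L))).1 hU
  have r0 : Fin.rev (0 : Fin 2) = 1 := by decide
  have r1 : Fin.rev (1 : Fin 2) = 0 := by decide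
  have h00 : (galAdicCompletionMap (L := L) (IsCMField.complexConj L) hw) (((u : GL (Fin 2) (w.1.adicCompletion L)) : Matrix (Fin 2) (Fin 2) (w.1.adicCompletion L)) 0 0) * ((u : GL (Fin 2) (w.1.adicCompletion L)) : Matrix (Fin 2) (Fin 2) (w.1.adicCompletion L)) 1 0 + (galAdicCompletionMap (L := L) (IsCMField.complexConj L) hw) (((u : GL (Fin 2) (w.1.adicCompletion L)) : Matrix (Fin 2) (Fin 2) (w.1.adicCompletion L)) 1 0) * ((u : GL (Fin 2) (w.1.adicCompletion L)) : Matrix (Fin 2) (Fin 2) (w.1.adicCompletion L)) 0 0 = 0 := by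
    have h := hrel 0 0
    rw [Fin.sum_univ_two, r0, r1, if_neg (by decide)] at h
    exact h
  have h11 : (galAdicCompletionMap (L := L) (IsCMField.complexConj L) hw) (((u : GL (Fin 2) (w.1.adicCompletion L)) : Matrix (Fin 2) (Fin 2) (w.1.adicCompletion L)) 0 1) * ((u : GL (Fin 2) (w.1.adicCompletion L)) : Matrix (Fin 2) (Fin 2) (w.1.adicCompletion L)) 1 1 + (galAdicCompletionMap (L := L) (IsCMField.complexConj L) hw) (((u : GL (Fin 2) (w.1.adicCompletion L)) : Matrix (Fin 2) (Fin 2) (w.1.adicCompletion L)) 1 1) * ((u : GL (Fin 2) (w.1.adicCompletion L)) : Matrix (Fin 2) (Fin 2) (w.1.adicCompletion L)) 0 1 = 0 := by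
    have h := hrel 1 1
    rw [Fin.sum_univ_two, r0, r1, if_neg (by decide)] at h
    exact h
  -- `σ(a)c + σ(c)a = 0`, `a, c ∈ 𝒪_w` ⇒ `|a| < 1 ∨ |c| < 1` (residual triviality of `σ_w` + `|2| = 1`)
  have key : ∀ a c : (w.1.adicCompletion L), Valued.v a ≤ 1 → Valued.v c ≤ 1 → (galAdicCompletionMap (L := L) (IsCMField.complexConj L) hw) a * c + (galAdicCompletionMap (L := L) (IsCMField.complexConj L) hw) c * a = 0 → Valued.v a < 1 ∨ Valued.v c < 1 := by
    intro a c ha hc h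
    have hεa := Liu2021.LemD1IndexedNonVacuityRamifiedConverse.valued_galAdicCompletionMap_sub_lt_one_of_ramified L (IsCMField.complexConj L) v
      (IsCMField.complexConj_ne_one L) w hw he a ha
    have hεc := Liu2021.LemD1IndexedNonVacuityRamifiedConverse.valued_galAdicCompletionMap_sub_lt_one_of_ramified L (IsCMField.complexConj L) v
      (IsCMField.complexConj_ne_one L) w hw he c hc
    have hε : Valued.v (((galAdicCompletionMap (L := L) (IsCMField.complexConj L) hw) a - a) * c + ((galAdicCompletionMap (L := L) (IsCMField.complexConj L) hw) c - c) * a) < 1 := by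
      refine Valuation.map_add_lt _ ?_ ?_
      · rw [Valuation.map_mul]; exact mul_lt_one_of_lt_of_le hεa hc
      · rw [Valuation.map_mul]; exact mul_lt_one_of_lt_of_le hεc ha
    have h2ac : 2 * (a * c) = -(((galAdicCompletionMap (L := L) (IsCMField.complexConj L) hw) a - a) * c + ((galAdicCompletionMap (L := L) (IsCMField.complexConj L) hw) c - c) * a) := by linear_combination h
    have hv : Valued.v (a * c) < 1 := by
      have h' := congrArg Valued.v h2ac
      rw [Valuation.map_mul, h2w, one_mul, Valuation.map_neg] at h'
      rw [h']; exact hε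
    rcases lt_or_eq_of_le ha with ha' | ha'
    · exact Or.inl ha'
    rcases lt_or_eq_of_le hc with hc' | hc'
    · exact Or.inr hc'
    rw [Valuation.map_mul, ha', hc', one_mul] at hv
    exact absurd hv (lt_irrefl _)
  have hA := key _ _ (hint 0 0) (hint 1 0) h00
  have hB := key _ _ (hint 0 1) (hint 1 1) h11
  -- `|det κ| = 1` forbids both products being small
  have hsmall : ¬ (Valued.v (((u : GL (Fin 2) (w.1.adicCompletion L)) : Matrix (Fin 2) (Fin 2) (w.1.adicCompletion L)) 0 0 * ((u : GL (Fin 2) (w.1.adicCompletion L)) : Matrix (Fin 2) (Fin 2) (w.1.adicCompletion L)) 1 1) < 1 ∧ Valued.v (((u : GL (Fin 2) (w.1.adicCompletion L)) : Matrix (Fin 2) (Fin 2) (w.1.adicCompletion L)) 0 1 * ((u : GL (Fin 2) (w.1.adicCompletion L)) : Matrix (Fin 2) (Fin 2) (w.1.adicCompletion L)) 1 0) < 1) := by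
    rintro ⟨h1, h2⟩
    have h : Valued.v (((u : GL (Fin 2) (w.1.adicCompletion L)) : Matrix (Fin 2) (Fin 2) (w.1.adicCompletion L))).det < 1 := by
      rw [Matrix.det_fin_two]; exact Valuation.map_sub_lt _ h1 h2
    rw [hdet] at h; exact lt_irrefl _ h
  rcases hA with h0 | h10
  · right
    refine ⟨h0, ?_⟩
    rcases hB with h01 | h1
    · exact absurd ⟨by rw [Valuation.map_mul]; exact mul_lt_one_of_lt_of_le h0 (hint 1 1),
        by rw [Valuation.map_mul]; exact mul_lt_one_of_lt_of_le h01 (hint 1 0)⟩ hsmall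
    · exact h1
  · left
    refine ⟨h10, ?_⟩
    rcases hB with h01 | h1
    · exact h01
    · exact absurd ⟨by rw [Valuation.map_mul, mul_comm]; exact mul_lt_one_of_lt_of_le h1 (hint 0 0),
        by rw [Valuation.map_mul, mul_comm]; exact mul_lt_one_of_lt_of_le h10 (hint 0 1)⟩ hsmall

include hw in
/-- The two residual types EXCLUDE each other (`|det κ|_w = 1`). [cite: Tits1979, §3.9] -/
theorem not_diagType_and_antidiagType (u : ↥(unitaryGroupOfForm (galAdicCompletionMap (L := L) (IsCMField.complexConj L) hw) (placeForm (Matrix.of fun i j : Fin 2 => if i.val + j.val + 1 = 2 then (1 : L) else 0) w.1))) (hu : (u : GL (Fin 2) (w.1.adicCompletion L)) ∈ glInt 2 (w.1.adicCompletion L)) :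
    ¬ ((Valued.v (((u : GL (Fin 2) (w.1.adicCompletion L)) : Matrix (Fin 2) (Fin 2) (w.1.adicCompletion L)) 1 0) < 1 ∧ Valued.v (((u : GL (Fin 2) (w.1.adicCompletion L)) : Matrix (Fin 2) (Fin 2) (w.1.adicCompletion L)) 0 1) < 1) ∧
        (Valued.v (((u : GL (Fin 2) (w.1.adicCompletion L)) : Matrix (Fin 2) (Fin 2) (w.1.adicCompletion L)) 0 0) < 1 ∧ Valued.v (((u : GL (Fin 2) (w.1.adicCompletion L)) : Matrix (Fin 2) (Fin 2) (w.1.adicCompletion L)) 1 1) < 1)) := by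
  rintro ⟨⟨h10, h01⟩, h00, _⟩
  have hint : ∀ i j, Valued.v (((u : GL (Fin 2) (w.1.adicCompletion L)) : Matrix (Fin 2) (Fin 2) (w.1.adicCompletion L)) i j) ≤ 1 := (coe_mem_glInt_iff_forall_v_le_one L w hw u).1 hu
  have hdet : Valued.v (((u : GL (Fin 2) (w.1.adicCompletion L)) : Matrix (Fin 2) (Fin 2) (w.1.adicCompletion L))).det = 1 := v_det_coe_eq_one_of_mem_placeForm L w hw u
  have h : Valued.v (((u : GL (Fin 2) (w.1.adicCompletion L)) : Matrix (Fin 2) (Fin 2) (w.1.adicCompletion L))).det < 1 := by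
    rw [Matrix.det_fin_two]
    refine Valuation.map_sub_lt _ ?_ ?_
    · rw [Valuation.map_mul]; exact mul_lt_one_of_lt_of_le h00 (hint 1 1)
    · rw [Valuation.map_mul]; exact mul_lt_one_of_lt_of_le h01 (hint 1 0)
  rw [hdet] at h; exact lt_irrefl _ h

include hw in
/-- **`P♯ M ↔ M ∈ D GL₂(𝒪_w) D⁻¹`** (`D = glDiagonal ![1, η]`) for unitary `M`: A-p16 (g31)'s entrywise χ♯ text `∀ a b, |η^b η^{−a} M_{ab}| ≤ 1` IS membership in the conjugated
level (★ `coe_mem_map_conj_glDiagonal_iff_forall_v_le_one`, `|det M| = 1`). [cite: Tits1979, §3.9] [cite: Serre1980Trees, Ch. II §1.3] -/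
theorem forall_v_sharp_iff_coe_mem_map_conj (η : (w.1.adicCompletion L)ˣ) (u : ↥(unitaryGroupOfForm (galAdicCompletionMap (L := L) (IsCMField.complexConj L) hw) (placeForm (Matrix.of fun i j : Fin 2 => if i.val + j.val + 1 = 2 then (1 : L) else 0) w.1))) :
    (∀ a b : Fin 2, Valued.v ((η : (w.1.adicCompletion L)) ^ (b : ℕ) * ((η : (w.1.adicCompletion L)) ^ (a : ℕ))⁻¹ * ((u : GL (Fin 2) (w.1.adicCompletion L)) : Matrix (Fin 2) (Fin 2) (w.1.adicCompletion L)) a b) ≤ 1) ↔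
      (u : GL (Fin 2) (w.1.adicCompletion L)) ∈ (glInt 2 (w.1.adicCompletion L)).map (MulAut.conj (glDiagonal 2 (w.1.adicCompletion L) ![1, η])).toMonoidHom := by
  rw [coe_mem_map_conj_glDiagonal_iff_forall_v_le_one L w hw η u]
  refine forall_congr' fun a => forall_congr' fun b => ?_
  rw [diagonal_mul_mul_diagonal_apply_two, vecTwo_sharp_scalar_eq _ η.ne_zero]

include hw in
/-- **`P♭ M ↔ M ∈ D′ GL₂(𝒪_w) D′⁻¹`** (`D′ = glDiagonal ![η, 1]`) for unitary `M`: the OTHER endpoint's level, `∀ a b, |η^a η^{−b} M_{ab}| ≤ 1`.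
[cite: Tits1979, §3.9] [cite: Serre1980Trees, Ch. II §1.3] -/
theorem forall_v_flat_iff_coe_mem_map_conj (η : (w.1.adicCompletion L)ˣ) (u : ↥(unitaryGroupOfForm (galAdicCompletionMap (L := L) (IsCMField.complexConj L) hw) (placeForm (Matrix.of fun i j : Fin 2 => if i.val + j.val + 1 = 2 then (1 : L) else 0) w.1))) :
    (∀ a b : Fin 2, Valued.v ((η : (w.1.adicCompletion L)) ^ (a : ℕ) * ((η : (w.1.adicCompletion L)) ^ (b : ℕ))⁻¹ * ((u : GL (Fin 2) (w.1.adicCompletion L)) : Matrix (Fin 2) (Fin 2) (w.1.adicCompletion L)) a b) ≤ 1) ↔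
      (u : GL (Fin 2) (w.1.adicCompletion L)) ∈ (glInt 2 (w.1.adicCompletion L)).map (MulAut.conj (glDiagonal 2 (w.1.adicCompletion L) ![η, 1])).toMonoidHom := by
  rw [Subgroup.mem_map_equiv, MulAut.conj_symm_apply]
  have hdet : Valued.v (((glDiagonal 2 (w.1.adicCompletion L) ![η, 1])⁻¹ * (u : GL (Fin 2) (w.1.adicCompletion L)) * glDiagonal 2 (w.1.adicCompletion L) ![η, 1] : GL (Fin 2) (w.1.adicCompletion L)) : Matrix (Fin 2) (Fin 2) (w.1.adicCompletion L)).det = 1 := by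
    rw [Units.val_mul, Units.val_mul, Matrix.det_units_conj']
    exact v_det_coe_eq_one_of_mem_placeForm L w hw u
  rw [mem_glInt_iff_forall_v_le_one_of_v_det_eq_one _ hdet, Units.val_mul, Units.val_mul, coe_glDiagonal_two_one_inv, coe_glDiagonal_two_one]
  refine forall_congr' fun a => forall_congr' fun b => ?_
  rw [diagonal_mul_mul_diagonal_apply_two, vecTwo_flat_scalar_eq _ η.ne_zero]

include hw in
/-- **TRANSPORT, DIAGONAL TYPE: `D⁻¹κD ∈ GL₂(𝒪_w)`** for `κ ∈ U ∩ GL₂(𝒪_w)` with `|κ₁₀|_w < 1` (`≤ |η|`, `η` a uniformiser): entries `κ₀₀, ηκ₀₁, η⁻¹κ₁₀, κ₁₁`, determinant `det κ`.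
[cite: Serre1980Trees, Ch. II §1.3] [cite: Tits1979, §3.9] -/
theorem glDiagonal_inv_mul_mul_glDiagonal_mem_glInt_of_diagType (η : (w.1.adicCompletion L)ˣ) (hη : Valued.v (η : (w.1.adicCompletion L)) = WithZero.exp (-1 : ℤ))
    (u : ↥(unitaryGroupOfForm (galAdicCompletionMap (L := L) (IsCMField.complexConj L) hw) (placeForm (Matrix.of fun i j : Fin 2 => if i.val + j.val + 1 = 2 then (1 : L) else 0) w.1))) (hu : (u : GL (Fin 2) (w.1.adicCompletion L)) ∈ glInt 2 (w.1.adicCompletion L)) (h10 : Valued.v (((u : GL (Fin 2) (w.1.adicCompletion L)) : Matrix (Fin 2) (Fin 2) (w.1.adicCompletion L)) 1 0) < 1) :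
    (glDiagonal 2 (w.1.adicCompletion L) ![1, η])⁻¹ * (u : GL (Fin 2) (w.1.adicCompletion L)) * glDiagonal 2 (w.1.adicCompletion L) ![1, η] ∈ glInt 2 (w.1.adicCompletion L) := by
  have hη0 : (η : (w.1.adicCompletion L)) ≠ 0 := η.ne_zero
  have hvη0 : Valued.v (η : (w.1.adicCompletion L)) ≠ 0 := (Valuation.ne_zero_iff _).2 hη0
  have hη1 : Valued.v (η : (w.1.adicCompletion L)) ≤ 1 := by rw [hη, ← WithZero.exp_zero, WithZero.exp_le_exp]; norm_num
  -- discreteness of `ℤᵐ⁰`: `x < 1 → x ≤ exp(−1)` (★ `withZero_le_exp_neg_one_of_lt_one`, not imported to keep this file's closure local)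
  have hle : ∀ {x : WithZero (Multiplicative ℤ)}, x < 1 → x ≤ WithZero.exp (-1 : ℤ) := fun hx => by
    rw [← WithZero.lt_mul_exp_iff_le WithZero.exp_ne_zero, ← WithZero.exp_add]; simpa using hx
  have hint : ∀ i j, Valued.v (((u : GL (Fin 2) (w.1.adicCompletion L)) : Matrix (Fin 2) (Fin 2) (w.1.adicCompletion L)) i j) ≤ 1 := (coe_mem_glInt_iff_forall_v_le_one L w hw u).1 hu
  have hdet : Valued.v (((glDiagonal 2 (w.1.adicCompletion L) ![1, η])⁻¹ * (u : GL (Fin 2) (w.1.adicCompletion L)) * glDiagonal 2 (w.1.adicCompletion L) ![1, η] : GL (Fin 2) (w.1.adicCompletion L)) : Matrix (Fin 2) (Fin 2) (w.1.adicCompletion L)).det = 1 := by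
    rw [Units.val_mul, Units.val_mul, Matrix.det_units_conj']
    exact v_det_coe_eq_one_of_mem_placeForm L w hw u
  rw [mem_glInt_iff_forall_v_le_one_of_v_det_eq_one _ hdet, Units.val_mul, Units.val_mul, coe_glDiagonal_one_two_inv, coe_glDiagonal_one_two]
  intro a b
  rw [diagonal_mul_mul_diagonal_apply_two]
  fin_cases a <;> fin_cases b
  · show Valued.v ((1 : (w.1.adicCompletion L)) * ((u : GL (Fin 2) (w.1.adicCompletion L)) : Matrix (Fin 2) (Fin 2) (w.1.adicCompletion L)) 0 0 * 1) ≤ 1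
    rw [one_mul, mul_one]; exact hint 0 0
  · show Valued.v ((1 : (w.1.adicCompletion L)) * ((u : GL (Fin 2) (w.1.adicCompletion L)) : Matrix (Fin 2) (Fin 2) (w.1.adicCompletion L)) 0 1 * (η : (w.1.adicCompletion L))) ≤ 1
    rw [one_mul, Valuation.map_mul]; exact mul_le_one' (hint 0 1) hη1
  · show Valued.v ((η : (w.1.adicCompletion L))⁻¹ * ((u : GL (Fin 2) (w.1.adicCompletion L)) : Matrix (Fin 2) (Fin 2) (w.1.adicCompletion L)) 1 0 * 1) ≤ 1
    rw [mul_one, Valuation.map_mul, map_inv₀]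
    calc (Valued.v (η : (w.1.adicCompletion L)))⁻¹ * Valued.v (((u : GL (Fin 2) (w.1.adicCompletion L)) : Matrix (Fin 2) (Fin 2) (w.1.adicCompletion L)) 1 0) ≤ (Valued.v (η : (w.1.adicCompletion L)))⁻¹ * Valued.v (η : (w.1.adicCompletion L)) :=
          mul_le_mul' le_rfl (hη ▸ hle h10)
      _ = 1 := inv_mul_cancel₀ hvη0
  · show Valued.v ((η : (w.1.adicCompletion L))⁻¹ * ((u : GL (Fin 2) (w.1.adicCompletion L)) : Matrix (Fin 2) (Fin 2) (w.1.adicCompletion L)) 1 1 * (η : (w.1.adicCompletion L))) ≤ 1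
    rw [mul_right_comm, inv_mul_cancel₀ hη0, one_mul]; exact hint 1 1

include hw in
/-- **TRANSPORT, ANTIDIAGONAL TYPE: `D⁻¹κD′ ∈ GL₂(𝒪_w)`** (`D = diag(1,η)`, `D′ = diag(η,1)`) for `κ ∈ U ∩ GL₂(𝒪_w)` with `|κ₁₁|_w < 1`: entries `ηκ₀₀, κ₀₁, κ₁₀, η⁻¹κ₁₁`,
determinant `det κ`. [cite: Serre1980Trees, Ch. II §1.3] [cite: Tits1979, §3.9] -/
theorem glDiagonal_inv_mul_mul_glDiagonal'_mem_glInt_of_antidiagType (η : (w.1.adicCompletion L)ˣ) (hη : Valued.v (η : (w.1.adicCompletion L)) = WithZero.exp (-1 : ℤ))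
    (u : ↥(unitaryGroupOfForm (galAdicCompletionMap (L := L) (IsCMField.complexConj L) hw) (placeForm (Matrix.of fun i j : Fin 2 => if i.val + j.val + 1 = 2 then (1 : L) else 0) w.1))) (hu : (u : GL (Fin 2) (w.1.adicCompletion L)) ∈ glInt 2 (w.1.adicCompletion L)) (h11 : Valued.v (((u : GL (Fin 2) (w.1.adicCompletion L)) : Matrix (Fin 2) (Fin 2) (w.1.adicCompletion L)) 1 1) < 1) :
    (glDiagonal 2 (w.1.adicCompletion L) ![1, η])⁻¹ * (u : GL (Fin 2) (w.1.adicCompletion L)) * glDiagonal 2 (w.1.adicCompletion L) ![η, 1] ∈ glInt 2 (w.1.adicCompletion L) := by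
  have hη0 : (η : (w.1.adicCompletion L)) ≠ 0 := η.ne_zero
  have hvη0 : Valued.v (η : (w.1.adicCompletion L)) ≠ 0 := (Valuation.ne_zero_iff _).2 hη0
  have hη1 : Valued.v (η : (w.1.adicCompletion L)) ≤ 1 := by rw [hη, ← WithZero.exp_zero, WithZero.exp_le_exp]; norm_num
  have hle : ∀ {x : WithZero (Multiplicative ℤ)}, x < 1 → x ≤ WithZero.exp (-1 : ℤ) := fun hx => by
    rw [← WithZero.lt_mul_exp_iff_le WithZero.exp_ne_zero, ← WithZero.exp_add]; simpa using hx
  have hint : ∀ i j, Valued.v (((u : GL (Fin 2) (w.1.adicCompletion L)) : Matrix (Fin 2) (Fin 2) (w.1.adicCompletion L)) i j) ≤ 1 := (coe_mem_glInt_iff_forall_v_le_one L w hw u).1 hu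
  have hdet0 : Valued.v (((u : GL (Fin 2) (w.1.adicCompletion L)) : Matrix (Fin 2) (Fin 2) (w.1.adicCompletion L))).det = 1 := v_det_coe_eq_one_of_mem_placeForm L w hw u
  rw [mem_glInt_iff_forall_v_le_one_and_v_det_eq_one, Units.val_mul, Units.val_mul, coe_glDiagonal_one_two_inv, coe_glDiagonal_two_one]
  refine ⟨fun a b => ?_, ?_⟩
  · rw [diagonal_mul_mul_diagonal_apply_two]
    fin_cases a <;> fin_cases b
    · show Valued.v ((1 : (w.1.adicCompletion L)) * ((u : GL (Fin 2) (w.1.adicCompletion L)) : Matrix (Fin 2) (Fin 2) (w.1.adicCompletion L)) 0 0 * (η : (w.1.adicCompletion L))) ≤ 1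
      rw [one_mul, Valuation.map_mul]; exact mul_le_one' (hint 0 0) hη1
    · show Valued.v ((1 : (w.1.adicCompletion L)) * ((u : GL (Fin 2) (w.1.adicCompletion L)) : Matrix (Fin 2) (Fin 2) (w.1.adicCompletion L)) 0 1 * 1) ≤ 1
      rw [one_mul, mul_one]; exact hint 0 1
    · show Valued.v ((η : (w.1.adicCompletion L))⁻¹ * ((u : GL (Fin 2) (w.1.adicCompletion L)) : Matrix (Fin 2) (Fin 2) (w.1.adicCompletion L)) 1 0 * (η : (w.1.adicCompletion L))) ≤ 1
      rw [mul_right_comm, inv_mul_cancel₀ hη0, one_mul]; exact hint 1 0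
    · show Valued.v ((η : (w.1.adicCompletion L))⁻¹ * ((u : GL (Fin 2) (w.1.adicCompletion L)) : Matrix (Fin 2) (Fin 2) (w.1.adicCompletion L)) 1 1 * 1) ≤ 1
      rw [mul_one, Valuation.map_mul, map_inv₀]
      calc (Valued.v (η : (w.1.adicCompletion L)))⁻¹ * Valued.v (((u : GL (Fin 2) (w.1.adicCompletion L)) : Matrix (Fin 2) (Fin 2) (w.1.adicCompletion L)) 1 1) ≤ (Valued.v (η : (w.1.adicCompletion L)))⁻¹ * Valued.v (η : (w.1.adicCompletion L)) :=
            mul_le_mul' le_rfl (hη ▸ hle h11)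
        _ = 1 := inv_mul_cancel₀ hvη0
  · rw [Matrix.det_mul, Matrix.det_mul, Matrix.det_diagonal, Matrix.det_diagonal, Fin.prod_univ_two, Fin.prod_univ_two]
    show Valued.v ((1 : (w.1.adicCompletion L)) * (η : (w.1.adicCompletion L))⁻¹ * (((u : GL (Fin 2) (w.1.adicCompletion L)) : Matrix (Fin 2) (Fin 2) (w.1.adicCompletion L))).det * ((η : (w.1.adicCompletion L)) * 1)) = 1
    rw [one_mul, mul_one, Valuation.map_mul, Valuation.map_mul, map_inv₀, hdet0, mul_one, inv_mul_cancel₀ hvη0]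

end Place

end Literature.NumberTheory.Automorphic.UnitaryGroup
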